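import Summits.Ventures.PercRepro.RankLevelSetExplicitLin2KeyCube

/-!
# PercRepro — THE CUBE KEY ROW AT `(q, p) = (16, 261 255)`, PART B: chunks 5 … 8 of 16 (p9, S4)

`proofs/SUBCLAIM-S4-p9.md` §S4.2⁗‴. The cube key `KeyC 16 261255 d` (RankLevelSetExplicitLin2KeyCube) at the coranks
`16401 … 32784` of the level-16 row at `p = 261 255`, by the kernel (`decide`, four chunks of
4 096); the row is assembled in RankLevelSetExplicitLin2CubeRowSixteen. Axioms: standard.
-/

namespace PercRepro

namespace ThmN

namespace Explicit

/-- The cube key row at `(q, p) = (16, 261 255)`, chunk 5 of 16: coranks `16401 … 20496`, by the kernel. -/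
theorem key_sixteen_cube_row_5 : ∀ t < 4096, KeyC 16 261255 (17 + (16384 + t)) := by decide +kernel

/-- The cube key row at `(q, p) = (16, 261 255)`, chunk 6 of 16: coranks `20497 … 24592`, by the kernel. -/
theorem key_sixteen_cube_row_6 : ∀ t < 4096, KeyC 16 261255 (17 + (20480 + t)) := by decide +kernel

/-- The cube key row at `(q, p) = (16, 261 255)`, chunk 7 of 16: coranks `24593 … 28688`, by the kernel. -/
theorem key_sixteen_cube_row_7 : ∀ t < 4096, KeyC 16 261255 (17 + (24576 + t)) := by decide +kernel

/-- The cube key row at `(q, p) = (16, 261 255)`, chunk 8 of 16: coranks `28689 … 32784`, by the kernel. -/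
theorem key_sixteen_cube_row_8 : ∀ t < 4096, KeyC 16 261255 (17 + (28672 + t)) := by decide +kernel

end Explicit

end ThmN

end PercRepro
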